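import Summits.MatrixMultiplication.MatrixMultiplication.Theses.OctaveBudget
import Summits.MatrixMultiplication.MatrixMultiplication.Theorems.OctaveBudgetLinearDecayTwoUpToFive
import Summits.MatrixMultiplication.MatrixMultiplication.Theorems.ShapeSubmodularityPerfectAmortisation
import Literature.Computability.AlgebraicComplexity.BigCwFourthOmega
import Literature.Computability.AlgebraicComplexity.RectangularExponentLaserCertificate
import Literature.Computability.AlgebraicComplexity.RectangularExponentAsymptoticRank
import Literature.Computability.AlgebraicComplexity.LaserMethodTypeCount
import Literature.Computability.AlgebraicComplexity.LaserMethodBigCW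
import Literature.Computability.AlgebraicComplexity.SchonhageRectangular
import Literature.Computability.AlgebraicComplexity.MaxEntropyGivenMarginals
import Literature.Computability.AlgebraicComplexity.CoppersmithWinograd1990Proofs
import Literature.Computability.AlgebraicComplexity.RectangularExponentBounds
import HarnessLib

/-!
# OctaveBudgetKernelFamily — the closed form of the first-power `CW_q` kernel family at the far edge,
and the base-range rung `K = 8` of the octave budget IN KERNEL
(decomp-mm cell, lens 5 «finite/base range + asymptotic regime + bridge», generation 11)

Landing form (part 1 of 4 of the kernel-rungs file of generations 4–10) for item
`stmt-MatrixMultiplication-25358` of `route-MatrixMultiplication-OctaveBudget` (`Theses/OctaveBudget.lean`,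
rev 7):

* `linearDecayTwoUpToEight_holds : LinearDecayTwoUpToEight` — the linear-decay law with constant `2`,
  `e(k) := ω(1,k,1) − (k+1) ≤ 2/k`, on `1 ≤ k ≤ 8`, table-free and decimal-free, from tree theorems only.

## The rung reductions (layer A)
One step of the chain is the landed `OctaveBudgetLinearDecayTwoUpToFive.rung_of_tail_bound`: from the rung
`(C, k₁)`, a value bound `e(κ₀) ≤ η` at some real `κ₀ ≤ k₁ + 1` and `η·K ≤ C`, the rung `(C, K)` (the
excess is antitone and nonnegative).  Hence `K = 8` from the two far-edge VALUES `e(3) ≤ 1/3`, `e(7) ≤ 1/4`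
(`rung_two_eight`), and the higher rungs `K = 12, 14, 16` and the `C`-dial rung `(3, 24)` MODULO further
values beyond `k = 8` (`linearDecayTwoUpToTwelve_of_farEdge`, `rung_two_fourteen`,
`linearDecayTwoUpToSixteen_of_farEdge`, `rung_three_twentyfour`), discharged in the companion files
`OctaveBudgetFivePattern{Diagonal,,Certs}.lean` by the full first power of `CW_q`.

## Lever (closed form of the kernel family)
The tree's PerfectAmortisation pipeline (`PerfectAmortisation.omegaRect_le_of_packing ∘
PerfectAmortisation.cwLaserPacking_of_stubs`, `Theorems/ShapeSubmodularityPerfectAmortisation*.lean`) gives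
for all integers `q ≥ 2`, `k ≥ 1`:  `ω(1,1,k) ≤ f(k,q) := (k+2)(log(q+2) − h(1/(k+2)))/log q`,
`h = Real.binEntropy`.  Since `(k+2)·h(1/(k+2)) = (k+2) log(k+2) − (k+1) log(k+1)`
(`mul_binEntropy_one_div`), the choice `q = 2k+2` makes every logarithm of `k+2` cancel:
  `f(k, 2k+2) = k + 1 + log 2 / log(2k+2)` (`rate_closed_form`), i.e.
  **`e(k) ≤ log 2 / log(2k+2)`** for every integer `k ≥ 1` (`excess_le_log_two_div`).
Consequences (all exact, no numerics):
* `e(k) ≤ 1/n` whenever `2k+2 = 2^n` (`excess_le_one_div`): `e(3) ≤ 1/3`, `e(7) ≤ 1/4`, `e(15) ≤ 1/5`;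
* ENVELOPE TEST `excess_le_div_of_pow_le`: `2^k ≤ (2k+2)^C ⟹ e(k) ≤ C/k` — the rung `(C, K)` is
  kernel-provable from this family alone whenever `2^K ≤ (2K+2)^C`: `C = 2 ↦ K = 8`
  (`linearDecayTwoUpToEight_holds`), `C = 3 ↦ K = 15` (`2^15 = 32^3`, `rung_three_fifteen`),
  `C = 4 ↦ K = 22` (`rung_four_twentytwo`); the reach grows like `K ≈ 7C`
  (`k·log 2/log(2k+2) → ∞`): unbounded `K` at growing `C`, NO uniform `C` — exactly the content of the
  route's open crux `LinearExcessDecay` (`K = ∞`), which this family provably does not reach;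
* free `q`: `q = 26` at `k = 9` gives `e(9) < 2/9` (`28^99 · 10^90 ≤ 26^92 · 11^99`, `farEdge_nine`), so
  the kernel family reaches exactly `K = 9` on the `2/k` envelope (`rung_two_nine`).

Lens reading: these rungs are the FINITE RANGE of the octave budget `LinearExcessDecay`
(`∃ C, ∀ k ≥ 1, e(k) ≤ C/k`) at `C = 2`; the ASYMPTOTIC REGIME is Coppersmith's `e(k) → 0`; the bridge
that would make a finite range bite is the route's crux `TailSubcriticalDoubling` — by itself no finite
range decides the budget (census: the first power of `CW_q` certifies `2/k` exactly up to `K₀ = 20`).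

References: [cite: CoppersmithWinograd1990, §6–§8]; [cite: Coppersmith1997, Thm 1]; [cite: LeGall2014, Thm 1.1];
[cite: HuangPan1998, §8]; [cite: VassilevskaWilliamsXuXuZhou2024, Table 1] (comparison only, not used).
-/

set_option linter.dupNamespace false -- `MatrixMultiplication.MatrixMultiplication` (summit = problem, D-0017)

-- the route items (defined in `Theses/OctaveBudget.lean`)
open Summit.MatrixMultiplication.MatrixMultiplication.Theses.OctaveBudget
  (LinearDecayTwoUpToFive LinearDecayTwoUpToEight LinearDecayTwoUpToTen LinearDecayTwoUpToTwelve
    LinearDecayTwoUpToSixteen)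

open Literature.Computability.AlgebraicComplexity

-- landed layer-A tools (items 25357): `excess_le : 1 ≤ p → e(p) ≤ 0.37295`,
-- `rung_of_tail_bound` (one step of the chain), `rung_two_five` — reused, not restated.
open Summit.MatrixMultiplication.MatrixMultiplication.Theorems.OctaveBudgetLinearDecayTwoUpToFive
  (excess_le rung_of_tail_bound rung_two_five linearDecayTwoUpToFive_holds)

/-! ## Part A — the rung reductions (layer A) -/

namespace Summit.MatrixMultiplication.MatrixMultiplication.Theorems.OctaveBudgetKernelFamily

/-- Rung `(2, 2)` from the square record alone (`0.37295 · 2 ≤ 2`). -/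
theorem rung_two_two : ∀ k : ℕ, 1 ≤ k → k ≤ 2 → omegaRect ℂ 1 k 1 - (k + 1) ≤ 2 / k :=
  rung_of_tail_bound (k₁ := 0) (κ₀ := 1) (η := 0.37295) (C := 2)
    (fun k hk hk0 => by omega) (by norm_num) (excess_le le_rfl) (by norm_num)

/-- Rung `(2, 6)` from the far-edge value `ω(1,3,1) ≤ 13/3`, i.e. `e(3) ≤ 1/3` (`(1/3)·6 ≤ 2`). -/
theorem rung_two_six (h3 : omegaRect ℂ 1 (3 : ℝ) 1 ≤ 13 / 3) :
    ∀ k : ℕ, 1 ≤ k → k ≤ 6 → omegaRect ℂ 1 k 1 - (k + 1) ≤ 2 / k :=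
  rung_of_tail_bound (k₁ := 2) (κ₀ := 3) (η := 1 / 3) rung_two_two (by norm_num) (by linarith) (by norm_num)

/-- Rung `(2, 8)` from `e(3) ≤ 1/3` and `ω(1,7,1) ≤ 33/4`, i.e. `e(7) ≤ 1/4` (`(1/4)·8 ≤ 2`). -/
theorem rung_two_eight (h3 : omegaRect ℂ 1 (3 : ℝ) 1 ≤ 13 / 3) (h7 : omegaRect ℂ 1 (7 : ℝ) 1 ≤ 33 / 4) :
    ∀ k : ℕ, 1 ≤ k → k ≤ 8 → omegaRect ℂ 1 k 1 - (k + 1) ≤ 2 / k :=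
  rung_of_tail_bound (k₁ := 6) (κ₀ := 7) (η := 1 / 4) (rung_two_six h3) (by norm_num) (by linarith)
    (by norm_num)

/-- **stmt-25358 reduced to two far-edge values** (discharged EXACTLY below:
first-power CW_8 at `k = 3`, CW_16 at `k = 7`). -/
theorem linearDecayTwoUpToEight_of_farEdge (h3 : omegaRect ℂ 1 (3 : ℝ) 1 ≤ 13 / 3)
    (h7 : omegaRect ℂ 1 (7 : ℝ) 1 ≤ 33 / 4) : LinearDecayTwoUpToEight :=
  rung_two_eight h3 h7

/-- Rung `(2, 12)` = stmt-26291 from the `K = 8` values plus ONE beyond-kernel value `e(κ₀) ≤ 1/6`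
at any real `κ₀ ≤ 9` (`(1/6)·12 ≤ 2`; census H1: full first power of CW_13 at κ = 8 gives 0.1397). -/
theorem linearDecayTwoUpToTwelve_of_farEdge (h3 : omegaRect ℂ 1 (3 : ℝ) 1 ≤ 13 / 3)
    (h7 : omegaRect ℂ 1 (7 : ℝ) 1 ≤ 33 / 4) {κ₀ : ℝ} (hκ : κ₀ ≤ 9)
    (hb : omegaRect ℂ 1 κ₀ 1 - (κ₀ + 1) ≤ 1 / 6) : LinearDecayTwoUpToTwelve :=
  rung_of_tail_bound (k₁ := 8) (κ₀ := κ₀) (η := 1 / 6) (rung_two_eight h3 h7)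
    (by push_cast; linarith) hb (by norm_num)

/-- Rung `(2, 14)` from the `K = 8` values plus `e(κ₁) ≤ 1/7` at some `κ₁ ≤ 9` (`(1/7)·14 ≤ 2`). -/
theorem rung_two_fourteen (h3 : omegaRect ℂ 1 (3 : ℝ) 1 ≤ 13 / 3)
    (h7 : omegaRect ℂ 1 (7 : ℝ) 1 ≤ 33 / 4) {κ₁ : ℝ} (hκ₁ : κ₁ ≤ 9)
    (hb₁ : omegaRect ℂ 1 κ₁ 1 - (κ₁ + 1) ≤ 1 / 7) :
    ∀ k : ℕ, 1 ≤ k → k ≤ 14 → omegaRect ℂ 1 k 1 - (k + 1) ≤ 2 / k :=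
  rung_of_tail_bound (k₁ := 8) (κ₀ := κ₁) (η := 1 / 7) (rung_two_eight h3 h7)
    (by push_cast; linarith) hb₁ (by norm_num)

/-- Rung `(2, 16)` = stmt-25359 from the `K = 8` values plus TWO beyond-kernel values:
`e(κ₁) ≤ 1/7` at some `κ₁ ≤ 9` and `e(κ₂) ≤ 1/8` at some `κ₂ ≤ 15` (`(1/8)·16 ≤ 2`).  (A single
`e(κ₀) ≤ 1/8` with `κ₀ ≤ 9` also suffices — take `κ₁ = κ₂ = κ₀` — but is not met by the first power,
census H1: ê₁(8) = 0.1397; the two-value form is what the census can certify: ê₁(9) vs 1/7,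
ê₁(15) vs 1/8.) -/
theorem linearDecayTwoUpToSixteen_of_farEdge (h3 : omegaRect ℂ 1 (3 : ℝ) 1 ≤ 13 / 3)
    (h7 : omegaRect ℂ 1 (7 : ℝ) 1 ≤ 33 / 4) {κ₁ : ℝ} (hκ₁ : κ₁ ≤ 9)
    (hb₁ : omegaRect ℂ 1 κ₁ 1 - (κ₁ + 1) ≤ 1 / 7) {κ₂ : ℝ} (hκ₂ : κ₂ ≤ 15)
    (hb₂ : omegaRect ℂ 1 κ₂ 1 - (κ₂ + 1) ≤ 1 / 8) : LinearDecayTwoUpToSixteen :=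
  rung_of_tail_bound (k₁ := 14) (κ₀ := κ₂) (η := 1 / 8) (rung_two_fourteen h3 h7 hκ₁ hb₁)
    (by push_cast; linarith) hb₂ (by norm_num)

/-! ## The C-dial of the finite range (lens 5: how far the finite range reaches at slope C)
`LinearDecayUpTo C K`-type rungs with a LARGER constant are weaker currency; the generic step shows
the price: a value `e(κ₀) ≤ η` extends the rung `(C, ·)` exactly up to `K = ⌊C/η⌋`.  With the
full-first-power values of census H1 (k·ê₁(k) = 0.77, 1.12, 1.71, 2.73, 4.76 at k = 4, 8, 16, 32,
64) the in-class reach is K*(2) ≈ 18, K*(3) ≈ 34, K*(5) ≈ 64: `LinearExcessDecay` = "∃ C, K*(C) = ∞". -/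

/-- Rung `(3, 24)` from the `K = 8` chain plus `e(κ) ≤ 1/8` at some `κ ≤ 9`
(illustration of the dial: the same value that gives `(2,16)` gives `(3,24)`). -/
theorem rung_three_twentyfour (h3 : omegaRect ℂ 1 (3 : ℝ) 1 ≤ 13 / 3)
    (h7 : omegaRect ℂ 1 (7 : ℝ) 1 ≤ 33 / 4) {κ : ℝ} (hκ : κ ≤ 9)
    (hb : omegaRect ℂ 1 κ 1 - (κ + 1) ≤ 1 / 8) :
    ∀ k : ℕ, 1 ≤ k → k ≤ 24 → omegaRect ℂ 1 k 1 - (k + 1) ≤ 3 / k := by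
  have h8 : ∀ k : ℕ, 1 ≤ k → k ≤ 8 → omegaRect ℂ 1 k 1 - (k + 1) ≤ 3 / k := fun k hk hk8 => by
    have hkpos : (0 : ℝ) < (k : ℝ) := by
      have : (1 : ℝ) ≤ (k : ℝ) := by exact_mod_cast hk
      linarith
    have := rung_two_eight h3 h7 k hk hk8
    calc omegaRect ℂ 1 k 1 - (k + 1) ≤ 2 / k := this
      _ ≤ 3 / k := by gcongr; norm_num
  exact rung_of_tail_bound (k₁ := 8) (κ₀ := κ) (η := 1 / 8) h8 (by push_cast; linarith) hb (by norm_num)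


/-! ## Part B — the closed form of the kernel family at the far edge, and the closers -/

/-- `(k+2)·h(1/(k+2)) = (k+2)·log(k+2) − (k+1)·log(k+1)` (`h = Real.binEntropy`, natural logs):
`h(θ) = θ log θ⁻¹ + (1−θ) log (1−θ)⁻¹` with `θ = 1/(k+2)`, `(1−θ)⁻¹ = (k+2)/(k+1)`. [folklore] -/
theorem mul_binEntropy_one_div (k : ℕ) :
    ((k : ℝ) + 2) * Real.binEntropy (1 / ((k : ℝ) + 2)) =
      ((k : ℝ) + 2) * Real.log ((k : ℝ) + 2) - ((k : ℝ) + 1) * Real.log ((k : ℝ) + 1) := by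
  have hx : (0 : ℝ) < (k : ℝ) + 2 := by positivity
  have hy : (0 : ℝ) < (k : ℝ) + 1 := by positivity
  have hx' : (k : ℝ) + 2 ≠ 0 := hx.ne'
  have hy' : (k : ℝ) + 1 ≠ 0 := hy.ne'
  have e1 : (1 / ((k : ℝ) + 2))⁻¹ = (k : ℝ) + 2 := by rw [one_div, inv_inv]
  have e0 : 1 - 1 / ((k : ℝ) + 2) = ((k : ℝ) + 1) / ((k : ℝ) + 2) := by
    rw [eq_div_iff hx', sub_mul, one_mul, one_div_mul_cancel hx']
    ring
  have e2 : (1 - 1 / ((k : ℝ) + 2))⁻¹ = ((k : ℝ) + 2) / ((k : ℝ) + 1) := by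
    rw [e0, inv_div]
  unfold Real.binEntropy
  rw [e1, e2, Real.log_div hx' hy', e0]
  field_simp
  ring

/-- **Closed form of the kernel family at `q = 2k+2`:** `f(k, 2k+2) = k + 1 + log 2 / log(2k+2)`
(every `log(k+2)` cancels: `log(2k+4) = log 2 + log(k+2)`, `log(2k+2) = log 2 + log(k+1)`). -/
theorem rate_closed_form (k : ℕ) :
    ((k : ℝ) + 2) * (Real.log (2 * (k : ℝ) + 2 + 2) - Real.binEntropy (1 / ((k : ℝ) + 2))) /
        Real.log (2 * (k : ℝ) + 2) = (k : ℝ) + 1 + Real.log 2 / Real.log (2 * (k : ℝ) + 2) := by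
  have hk0 : (0 : ℝ) ≤ (k : ℝ) := Nat.cast_nonneg k
  have hL2 : Real.log (2 * (k : ℝ) + 2 + 2) = Real.log 2 + Real.log ((k : ℝ) + 2) := by
    rw [show (2 * (k : ℝ) + 2 + 2) = 2 * ((k : ℝ) + 2) by ring,
      Real.log_mul two_ne_zero (by positivity)]
  have hL1 : Real.log (2 * (k : ℝ) + 2) = Real.log 2 + Real.log ((k : ℝ) + 1) := by
    rw [show (2 * (k : ℝ) + 2) = 2 * ((k : ℝ) + 1) by ring,
      Real.log_mul two_ne_zero (by positivity)]
  have hlog2 : 0 < Real.log 2 := Real.log_pos one_lt_two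
  have hlogk : 0 ≤ Real.log ((k : ℝ) + 1) := Real.log_nonneg (by linarith)
  have hL : Real.log 2 + Real.log ((k : ℝ) + 1) ≠ 0 := by linarith
  rw [mul_sub, mul_binEntropy_one_div, hL2, hL1]
  field_simp
  ring

/-- **The kernel far-edge bound (first-power `CW_{2k+2}`, tree pipeline):**
`e(k) = ω(1,k,1) − (k+1) ≤ log 2 / log(2k+2)` for every integer `k ≥ 1`. -/
theorem excess_le_log_two_div (k : ℕ) (hk : 1 ≤ k) :
    omegaRect ℂ 1 k 1 - (k + 1) ≤ Real.log 2 / Real.log (2 * (k : ℝ) + 2) := by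
  have h := PerfectAmortisation.omegaRect_le_of_packing PerfectAmortisation.cwLaserPacking_of_stubs (show 2 ≤ 2 * k + 2 by omega) hk
  push_cast at h
  rw [rate_closed_form] at h
  rw [omegaRect_one_mid_one]
  linarith

/-- `e(k) ≤ 1/n` whenever `2k + 2 = 2^n` (`log 2 / log 2^n = 1/n`): `e(3) ≤ 1/3`, `e(7) ≤ 1/4`,
`e(15) ≤ 1/5`, `e(31) ≤ 1/6`, …. -/
theorem excess_le_one_div {k n : ℕ} (hk : 1 ≤ k) (h : 2 * k + 2 = 2 ^ n) :
    omegaRect ℂ 1 k 1 - (k + 1) ≤ 1 / n := by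
  have hn : n ≠ 0 := by
    rintro rfl
    rw [pow_zero] at h
    omega
  have hlog2 : 0 < Real.log 2 := Real.log_pos one_lt_two
  have hcast : 2 * (k : ℝ) + 2 = (2 : ℝ) ^ n := by exact_mod_cast h
  have h1 := excess_le_log_two_div k hk
  rw [hcast, Real.log_pow] at h1
  have h2 : Real.log 2 / (n * Real.log 2) = 1 / n := by
    rw [mul_comm, ← div_div, div_self hlog2.ne']
  exact h1.trans_eq h2

/-- **Envelope test:** `2^k ≤ (2k+2)^C ⟹ e(k) ≤ C/k` (take logarithms: `k log 2 ≤ C log(2k+2)`). -/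
theorem excess_le_div_of_pow_le {k C : ℕ} (hk : 1 ≤ k) (h : 2 ^ k ≤ (2 * k + 2) ^ C) :
    omegaRect ℂ 1 k 1 - (k + 1) ≤ C / k := by
  have hk0 : (0 : ℝ) < (k : ℝ) := by exact_mod_cast (by omega : 0 < k)
  have hlog2 : 0 < Real.log 2 := Real.log_pos one_lt_two
  have hq1 : (1 : ℝ) < 2 * (k : ℝ) + 2 := by linarith
  have hL : 0 < Real.log (2 * (k : ℝ) + 2) := Real.log_pos hq1
  have hcast : ((2 : ℝ) ^ k) ≤ (2 * (k : ℝ) + 2) ^ C := by exact_mod_cast h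
  have hlog : (k : ℝ) * Real.log 2 ≤ (C : ℝ) * Real.log (2 * (k : ℝ) + 2) := by
    rw [← Real.log_pow, ← Real.log_pow]
    exact Real.log_le_log (by positivity) hcast
  have h1 := excess_le_log_two_div k hk
  have h2 : Real.log 2 / Real.log (2 * (k : ℝ) + 2) ≤ C / k := by
    rw [div_le_div_iff₀ hL hk0]
    linarith
  exact h1.trans h2

/-- Far-edge value `ω(1,3,1) ≤ 13/3` (`2·3+2 = 2^3`: `e(3) ≤ 1/3`; first-power `CW_8`). -/
theorem farEdge_three : omegaRect ℂ 1 (3 : ℝ) 1 ≤ 13 / 3 := by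
  have h := excess_le_one_div (k := 3) (n := 3) (by norm_num) (by norm_num)
  norm_num at h
  linarith

/-- Far-edge value `ω(1,7,1) ≤ 33/4` (`2·7+2 = 2^4`: `e(7) ≤ 1/4`; first-power `CW_16`). -/
theorem farEdge_seven : omegaRect ℂ 1 (7 : ℝ) 1 ≤ 33 / 4 := by
  have h := excess_le_one_div (k := 7) (n := 4) (by norm_num) (by norm_num)
  norm_num at h
  linarith

/-- Far-edge value `ω(1,15,1) ≤ 81/5` (`2·15+2 = 2^5`: `e(15) ≤ 1/5`; first-power `CW_32`). -/
theorem farEdge_fifteen : omegaRect ℂ 1 (15 : ℝ) 1 ≤ 81 / 5 := by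
  have h := excess_le_one_div (k := 15) (n := 5) (by norm_num) (by norm_num)
  norm_num at h
  linarith

/-- The rate bound at any `(q, k)`, multiplied out and with the entropy in closed form:
`e(k) · log q ≤ (k+2) log(q+2) − [(k+2) log(k+2) − (k+1) log(k+1)] − (k+1) log q`. -/
theorem excess_mul_log_le (q k : ℕ) (hq : 2 ≤ q) (hk : 1 ≤ k) :
    (omegaRect ℂ 1 k 1 - (k + 1)) * Real.log q ≤
      ((k : ℝ) + 2) * Real.log ((q : ℝ) + 2) -
        (((k : ℝ) + 2) * Real.log ((k : ℝ) + 2) - ((k : ℝ) + 1) * Real.log ((k : ℝ) + 1)) -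
        ((k : ℝ) + 1) * Real.log (q : ℝ) := by
  have h := PerfectAmortisation.omegaRect_le_of_packing PerfectAmortisation.cwLaserPacking_of_stubs hq hk
  rw [mul_sub, mul_binEntropy_one_div] at h
  have hq1 : (1 : ℝ) < q := by exact_mod_cast (lt_of_lt_of_le one_lt_two hq)
  have hL : 0 < Real.log (q : ℝ) := Real.log_pos hq1
  have h' := (le_div_iff₀ hL).1 h
  rw [omegaRect_one_mid_one, sub_mul]
  linarith

/-- Far-edge value `ω(1,9,1) ≤ 92/9`, i.e. `e(9) ≤ 2/9`, from the first power of `CW_26` at `k = 9`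
(`f(9,26) − 10 = 0.22169… ≤ 0.2222…`), certified by the INTEGER comparison
`28^99 · 10^90 ≤ 26^92 · 11^99` (take logarithms).  This is the exact reach of the full first-power
kernel family on the `2/k` envelope (`k = 10`: `min_q f(10,q) − 11 = 0.21547 > 1/5`). -/
theorem farEdge_nine : omegaRect ℂ 1 (9 : ℝ) 1 ≤ 92 / 9 := by
  have h := excess_mul_log_le 26 9 (by norm_num) (by norm_num)
  simp only [Nat.cast_ofNat] at h
  have e28 : (26 : ℝ) + 2 = 28 := by norm_num
  have e11 : (9 : ℝ) + 2 = 11 := by norm_num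
  have e10 : (9 : ℝ) + 1 = 10 := by norm_num
  rw [e28, e11, e10] at h
  have hL : 0 < Real.log 26 := Real.log_pos (by norm_num)
  have hnat : (28 : ℝ) ^ 99 * (10 : ℝ) ^ 90 ≤ (26 : ℝ) ^ 92 * (11 : ℝ) ^ 99 := by norm_num
  have key : 99 * Real.log 28 + 90 * Real.log 10 ≤ 92 * Real.log 26 + 99 * Real.log 11 := by
    have := Real.log_le_log (by positivity) hnat
    rw [Real.log_mul (by positivity) (by positivity), Real.log_mul (by positivity) (by positivity),
      Real.log_pow, Real.log_pow, Real.log_pow, Real.log_pow] at this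
    push_cast at this
    linarith
  have h2 : (omegaRect ℂ 1 (9 : ℝ) 1 - 10) * Real.log 26 ≤ 2 / 9 * Real.log 26 := by
    linarith
  have h3 := le_of_mul_le_mul_right h2 hL
  linarith

/-- **stmt-MatrixMultiplication-25358 PROVED (route decl by name):** `ω(1,k,1) ≤ k + 1 + 2/k` for the
integers `1 ≤ k ≤ 8` — envelope test `2^k ≤ (2k+2)^2` for `k ≤ 8` (`256 ≤ 324` at `k = 8`). -/
theorem linearDecayTwoUpToEight_holds : LinearDecayTwoUpToEight := by
  intro k hk hk8
  have h : 2 ^ k ≤ (2 * k + 2) ^ 2 := by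
    interval_cases k <;> norm_num
  exact_mod_cast excess_le_div_of_pow_le (C := 2) hk h

/-- The same rung through the layer-A chain (`e(3) ≤ 1/3` covers `k ≤ 6`, `e(7) ≤ 1/4` covers
`k ≤ 8`; `k ≤ 2` from the square record) — certifies that the reduction of Part A composes. -/
example : LinearDecayTwoUpToEight :=
  linearDecayTwoUpToEight_of_farEdge farEdge_three farEdge_seven

/-- The C-dial in kernel: rung `(3, 15)` — `e(k) ≤ 3/k` for `1 ≤ k ≤ 15` (`2^15 = 32^3` exactly). -/
theorem rung_three_fifteen : ∀ k : ℕ, 1 ≤ k → k ≤ 15 → omegaRect ℂ 1 k 1 - (k + 1) ≤ 3 / k := by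
  intro k hk hk15
  have h : 2 ^ k ≤ (2 * k + 2) ^ 3 := by
    interval_cases k <;> norm_num
  exact_mod_cast excess_le_div_of_pow_le (C := 3) hk h

/-- The C-dial in kernel: rung `(4, 22)` — `e(k) ≤ 4/k` for `1 ≤ k ≤ 22` (`2^22 ≤ 46^4`). -/
theorem rung_four_twentytwo : ∀ k : ℕ, 1 ≤ k → k ≤ 22 → omegaRect ℂ 1 k 1 - (k + 1) ≤ 4 / k := by
  intro k hk hk22
  have h : 2 ^ k ≤ (2 * k + 2) ^ 4 := by
    interval_cases k <;> norm_num
  exact_mod_cast excess_le_div_of_pow_le (C := 4) hk h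

/-- **Rung `(2, 9)`: the exact reach of the full first-power kernel family on the linear envelope**
(`k ≤ 8` by the envelope test, `k = 9` by `farEdge_nine`). -/
theorem rung_two_nine : ∀ k : ℕ, 1 ≤ k → k ≤ 9 → omegaRect ℂ 1 k 1 - (k + 1) ≤ 2 / k := by
  intro k hk hk9
  rcases Nat.lt_or_ge k 9 with h | h
  · exact linearDecayTwoUpToEight_holds k hk (by omega)
  · obtain rfl : k = 9 := le_antisymm hk9 h
    have h9 := farEdge_nine
    push_cast
    linarith

end Summit.MatrixMultiplication.MatrixMultiplication.Theorems.OctaveBudgetKernelFamily
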